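import Mathlib
import HarnessLib.Audit
import Summits.PneNP.PneNP.Theorems.PstarMultiUnionSplit
import Summits.PneNP.PneNP.Theorems.PstarLocalUnionFive

/-!
# Outside partners: `MultiUnionFive → TerminalFiveOutside`, and the `W`-constant class is a theorem (ROUND-25, memo §14.29 (Rb) / §14.30)

FRONTIER range-avoidance ladder, rung F-N3, ROUND 25 (cell `pnp-ideate`, planner memo `r24/CORE-BOUND-NOTES.md` §14.29–§14.30, planner p3 g23's
`r25/SketchMultiUnion.lean` (the sorried `terminalFiveOutside_of_multiUnionFive`); restricted-model proof complexity — nothing here bears on `P` versus `NP`).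

* `zset` — **the outside partner set**: the outside variables occurring in an AND slot of a privates-touching monomial of `w₁` or `w₂`;
* `fibG_clean` — under `OutsidePartners` the fibre monomials over `zset` avoid the chord privates (hun);
* `terminalFiveOutside_of_multiUnionFive` — **THE REDUCTION** (`PstarMultiUnionSplit.multiUnionTerminal_fib` with `Zs := zset`): `MultiUnionFive → TerminalFiveOutside`;
* `card_le_five_of_outside_fixed` — **the `W`-constant instance class is a theorem** (`PstarLocalUnionFive.multiUnionFiveFixed_holds`): a terminal core with admissible
  `F`, outside partners, and `w₂` touching no variable of `zset` (so every private gate is `w₁`'s; any number of outside partners, hubs `(p_e, z), (p_f, z)`, partners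
  read linearly by `w₁`, several partners per private) has `#J₀ ≤ 5`.  `PstarUnionFive.terminalFiveFresh_holds` is its one-variable case.
-/

set_option linter.dupNamespace false -- `Summit.PneNP.PneNP.…`: summit = sub-problem name (D-0017 single-conjunct layout)

open Finset Literature.Computability.Complexity
open scoped symmDiff
open Summit.PneNP.PneNP.Theorems.PstarTyped (Typed)
open Summit.PneNP.PneNP.Theorems.PstarSALevel (varSet bdry BoundaryExpanding SimpleOverlap)
open Summit.PneNP.PneNP.Theorems.PstarCoreBound (XorClosed)
open Summit.PneNP.PneNP.Theorems.PstarChordRepair (IsChord)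
open Summit.PneNP.PneNP.Theorems.PstarChordBridgeCotree (Peelable)
open Summit.PneNP.PneNP.Theorems.PstarChordBridgeTools (privs mem_privs)
open Summit.PneNP.PneNP.Theorems.PstarCoreBoundTargets (Terminal)
open Summit.PneNP.PneNP.Theorems.PstarMultiUnion (Outside OutsidePartners TerminalFiveOutside fzero MultiUnionFive MultiUnionFiveFixed)
open Summit.PneNP.PneNP.Theorems.PstarMultiUnionSplit (fib fibG mem_fibG multiUnionTerminal_fib fib_const)
open Summit.PneNP.PneNP.Theorems.PstarLocalUnionFive (multiUnionFiveFixed_holds)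

namespace Summit.PneNP.PneNP.Theorems.PstarMultiUnionOutside

variable {n m : ℕ}

/-! ## The outside partner set -/

open scoped Classical in
/-- **The outside partner set**: the outside variables occurring in an AND slot of a privates-touching monomial of `w₁` or `w₂`. -/
noncomputable def zset (I : LocalMap 4 n m) (J₀ F : Finset (Fin m)) (w₁ w₂ : Finset (Fin n) × Finset (Fin m) × Bool) : Finset (Fin n) :=
  (((w₁.2.1 ∪ w₂.2.1).filter fun g => I.vars g 2 ∈ privs I (J₀ \ F) ∨ I.vars g 3 ∈ privs I (J₀ \ F)).biUnion
    fun g => ({I.vars g 2, I.vars g 3} : Finset (Fin n))).filter fun z => Outside I J₀ z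

/-- `zset` is outside `J₀`. -/
theorem outside_of_mem_zset (I : LocalMap 4 n m) {J₀ F : Finset (Fin m)} {w₁ w₂ : Finset (Fin n) × Finset (Fin m) × Bool} {z : Fin n}
    (hz : z ∈ zset I J₀ F w₁ w₂) : Outside I J₀ z := by
  classical
  unfold zset at hz
  exact (mem_filter.1 hz).2

/-- Under outside partners, **the fibre monomials over `zset` are hun-clean**. -/
theorem fibG_clean (I : LocalMap 4 n m) {J₀ F : Finset (Fin m)} {w₁ w₂ : Finset (Fin n) × Finset (Fin m) × Bool}
    (hout : OutsidePartners I J₀ F w₁ w₂) :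
    ∀ g ∈ fibG I w₁ (zset I J₀ F w₁ w₂) ∪ fibG I w₂ (zset I J₀ F w₁ w₂), ∀ v ∈ privs I (J₀ \ F), I.vars g 2 ≠ v ∧ I.vars g 3 ≠ v := by
  classical
  intro g hg v hv
  have hgG : g ∈ w₁.2.1 ∪ w₂.2.1 ∧ I.vars g 2 ∉ zset I J₀ F w₁ w₂ ∧ I.vars g 3 ∉ zset I J₀ F w₁ w₂ := by
    rcases mem_union.1 hg with h | h
    · obtain ⟨h1, h2, h3⟩ := (mem_fibG I w₁ _).1 h; exact ⟨mem_union_left _ h1, h2, h3⟩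
    · obtain ⟨h1, h2, h3⟩ := (mem_fibG I w₂ _).1 h; exact ⟨mem_union_right _ h1, h2, h3⟩
  obtain ⟨hgU, h2, h3⟩ := hgG
  have mem_z : ∀ z, (I.vars g 2 ∈ privs I (J₀ \ F) ∨ I.vars g 3 ∈ privs I (J₀ \ F)) → (z = I.vars g 2 ∨ z = I.vars g 3) → Outside I J₀ z →
      z ∈ zset I J₀ F w₁ w₂ := by
    intro z htouch hz hO
    unfold zset
    refine mem_filter.2 ⟨mem_biUnion.2 ⟨g, mem_filter.2 ⟨hgU, htouch⟩, ?_⟩, hO⟩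
    rw [mem_insert, mem_singleton]; exact hz
  constructor
  · intro e
    exact h3 (mem_z _ (Or.inl (e ▸ hv)) (Or.inr rfl) ((hout g hgU v hv).1 e))
  · intro e
    exact h2 (mem_z _ (Or.inr (e ▸ hv)) (Or.inl rfl) ((hout g hgU v hv).2 e))

/-- **THE REDUCTION: `MultiUnionFive → TerminalFiveOutside`** (the multi-variable union split; `sat_split_fresh` for all outside partners at once). -/
theorem terminalFiveOutside_of_multiUnionFive (h : MultiUnionFive) : TerminalFiveOutside := by
  intro n m r I hI hT hS hB y J₀ w₁ w₂ ht F hF hP hmax hchord hout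
  exact h n m r I hI hT hS hB y J₀ n (fib I w₁ (zset I J₀ F w₁ w₂)) (fib I w₂ (zset I J₀ F w₁ w₂))
    (multiUnionTerminal_fib I hT ht fun z hz => outside_of_mem_zset I hz) F hF hP hmax hchord (fibG_clean I hout)

/-! ## The `W`-constant instance class -/

/-- **Outside partners with `w₂` off the partner set: `#J₀ ≤ 5`.**  A terminal core with admissible `F`, outside partners, and `w₂` touching no variable of `zset`
(so all private gates belong to `w₁`; any number of outside partners, hubs, partners read linearly) has at most five outputs. -/
theorem card_le_five_of_outside_fixed (I : LocalMap 4 n m) (hI : I.IsPure xorAndPred) (hT : Typed I)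
    (hS : SimpleOverlap I) {r : ℕ} (hB : BoundaryExpanding r I) {y : Fin m → Bool} {J₀ : Finset (Fin m)}
    {w₁ w₂ : Finset (Fin n) × Finset (Fin m) × Bool} (ht : Terminal I r y J₀ w₁ w₂) {F : Finset (Fin m)} (hF : F ⊆ J₀) (hP : Peelable I F)
    (hmax : ∀ F', F ⊆ F' → F' ⊆ J₀ → Peelable I F' → F' = F) (hchord : ∀ e ∈ J₀ \ F, IsChord I J₀ e) (hout : OutsidePartners I J₀ F w₁ w₂)
    (hw₂ : ∀ z ∈ zset I J₀ F w₁ w₂, z ∉ w₂.1 ∧ ∀ g ∈ w₂.2.1, I.vars g 2 ≠ z ∧ I.vars g 3 ≠ z) : J₀.card ≤ 5 := by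
  classical
  set Zs := zset I J₀ F w₁ w₂
  have hM := multiUnionTerminal_fib I hT ht (Zs := Zs) fun z hz => outside_of_mem_zset I hz
  -- the fibres of `w₂` do not depend on `ξ`
  have hW : ∀ ξ, fib I w₂ Zs ξ = fib I w₂ Zs (fzero n) := fun ξ => fib_const I w₂ Zs hw₂ ξ
  exact multiUnionFiveFixed_holds n m r I hI hT hS hB y J₀ n (fib I w₁ Zs) (fib I w₂ Zs) hM hW F hF hP hmax hchord (fibG_clean I hout)

end Summit.PneNP.PneNP.Theorems.PstarMultiUnionOutside
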